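import Summits.NavierStokesRegularity.FunctionalMining.StretchingClassConst
import Summits.NavierStokesRegularity.FunctionalMining.StretchingLowerShearKill
import HarnessLib

/-!
# FunctionalMining — K1-Q1 CLASS constants, part 2: `C_pressureless = 2√3/9` EXACTLY (dict seat, staged)

NS FUNCTIONAL MINING cell (`pub-nsfunc`), dictionary seat gen 7 — **search for candidate a priori
estimates; no regularity claim.** STATIC field inequalities only: nothing about Navier–Stokes solutions
is asserted anywhere in this file.

Part 1 (`StretchingClassConst.lean`) typed the class constants `stretchingSupConstOn 𝒞` and proved, from
tree files only, `0.2381 ≤ C_pressureless ≤ 2√3/9` and `0.2381 ≤ C_{2.5D} ≤ ½`. This part threads the class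
hypothesis through the prove seat's COMPOSITION fields `ShearComposition.u g T c = (0, −c g(x₀), T(x₁+g(x₀)))`
(`StretchingLowerShear.lean` + `StretchingLowerShearKill.lean`: `σ = cγτ`, `ℰ = (τ(1+γ)+c²γ)/2`, the
smoothed-sawtooth ladder `not_stretchingSupBound_saw` / `tendsto_ladder` with limit ratio `2√3/9`): they are
2½-dimensional (`∂₂u ≡ 0`) AND pressureless (`∇u` nilpotent ⇒ `|S|_F² = ½|ω|²`), so

* **`stretchingSupConstOn IsPressurelessGrad = 2√3/9` EXACTLY** (`stretchingSupConstOn_pressureless_eq`;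
  upper half = tree `enstrophyProduction_le_of_strainSq_eq_half_vorticitySq`, p206571 — Betchov–Miller);
* **`2√3/9 ≤ stretchingSupConstOn IsTwoHalfD ≤ ½`** — the bank's hand theorem `C_{2.5D} = ½` (K1Q1-HALF
  Thm 1/2) is NOT formalised (node `PlanarCellFamily` of `StretchingNestedTargets.lean`);
* the chain `C_pressureless ≤ C_{2.5D} ≤ C⋆ ≤ 2/√3` (`stretchingSupConstOn_chain`).

[ours; elementary order bookkeeping + the cited tree theorems; bank `K1Q1-PRESSURELESS.md`]
-/

noncomputable section

open Set Filter Topology MeasureTheory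

namespace Summit.NavierStokesRegularity.FunctionalMining

open Literature.Analysis Literature.Analysis.FunctionSpaces Literature.Analysis.FunctionSpaces.Torus
open Literature.Analysis.FluidPDE

/-! ## 1. The composition fields lie in both classes; the ladder inside a class -/

namespace ShearComposition

variable (g T : ShearProfile) (c : ℝ)

/-- `u = (0, −c g(x₀), T(x₁+g(x₀)))` is 2½-dimensional (`∂₂u ≡ 0`). [ours; elementary] -/
theorem isTwoHalfD_u : IsTwoHalfD (u g T c) :=
  ⟨2, fun x => by rw [partialDeriv_two_u]; rfl⟩

/-- **`u` has a pressureless gradient**: `∇u` is nilpotent (strictly triangular: `∂₀u = (0, −cg', g'T')`,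
`∂₁u = (0, 0, T')`, `∂₂u = 0`), so `|S|_F² = ½(c²g'² + (1+g'²)T'²) = ½|ω|²`. [ours; elementary] -/
theorem isPressurelessGrad_u : IsPressurelessGrad (u g T c) := by
  intro x
  obtain ⟨h00, h01, h02⟩ := partialDeriv_zero_u g T c x
  obtain ⟨h10, h11, h12⟩ := partialDeriv_one_u g T c x
  have h2 := partialDeriv_two_u g T c
  rw [torusVorticitySqAt_u]
  simp only [Fin.sum_univ_three, h00, h01, h02, h10, h11, h12, h2, Pi.zero_apply, PiLp.zero_apply]
  ring

/-- **Kills inside a class along composition fields** (the prove seat's `not_stretchingSupBound_shear`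
with the class hypothesis threaded through): if `u g T c ∈ 𝒞`, `|g'| ≤ G`, `|T'| ≤ Θ`, `c > 0` and
`γ = ∫₀¹g'², τ = ∫₀¹T'² > 0`, then `StretchingSupBoundOn 𝒞 C` fails for every
`C < 2cγτ / (√(c²G² + (1+G²)Θ²)·(τ(1+γ) + c²γ))`. Search for candidate a priori estimates; no
regularity claim. [ours] -/
theorem not_stretchingSupBoundOn_shear
    {𝒞 : (UnitAddTorus (Fin 3) → EuclideanSpace ℝ (Fin 3)) → Prop} (h𝒞 : 𝒞 (u g T c))
    {G Θ : ℝ} (hG : ∀ t, |deriv g t| ≤ G) (hΘ : ∀ t, |deriv T t| ≤ Θ)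
    (hc : 0 < c) (hγ : 0 < msq g) (hτ : 0 < msq T) {C : ℝ}
    (hC : C < 2 * c * msq g * msq T /
      (Real.sqrt (c ^ 2 * G ^ 2 + (1 + G ^ 2) * Θ ^ 2) * (msq T * (1 + msq g) + c ^ 2 * msq g))) :
    ¬ StretchingSupBoundOn 𝒞 C := by
  intro h
  have hGpos : 0 < G := pos_of_msq_pos hG hγ
  have hQ : 0 < c ^ 2 * G ^ 2 + (1 + G ^ 2) * Θ ^ 2 := by positivity
  obtain ⟨M, hM⟩ : ∃ M, M = Real.sqrt (c ^ 2 * G ^ 2 + (1 + G ^ 2) * Θ ^ 2) := ⟨_, rfl⟩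
  have hM0 : 0 < M := by rw [hM]; exact Real.sqrt_pos.2 hQ
  have hM2 : M ^ 2 = c ^ 2 * G ^ 2 + (1 + G ^ 2) * Θ ^ 2 := by rw [hM, Real.sq_sqrt hQ.le]
  have hω : ∀ x, torusVorticitySqAt (u g T c) x ≤ M ^ 2 := fun x => by
    rw [hM2]; exact torusVorticitySqAt_u_le g T c hG hΘ x
  have hle := h (Fintype.card_fin 3) (u g T c) (isSmooth_u g T c) (isDivFree_u g T c) h𝒞 M hM0.le hω
  rw [enstrophyProduction_u, torusEnstrophy_u] at hle
  rw [← hM] at hC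
  have hD : 0 < M * (msq T * (1 + msq g) + c ^ 2 * msq g) := by positivity
  have hrC : 2 * c * msq g * msq T / (M * (msq T * (1 + msq g) + c ^ 2 * msq g)) ≤ C := by
    rw [div_le_iff₀ hD]; nlinarith [hle]
  linarith

/-- **Kills inside a class along the smoothed-sawtooth ladder**: if the ladder fields
`u S_ε S_ε 1` lie in `𝒞`, then `¬ StretchingSupBoundOn 𝒞 C` for every `C < 2(1−4ε)/(√3(3−4ε))`,
`0 < ε ≤ 1/16`. Search for candidate a priori estimates; no regularity claim. [ours] -/
theorem not_stretchingSupBoundOn_saw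
    {𝒞 : (UnitAddTorus (Fin 3) → EuclideanSpace ℝ (Fin 3)) → Prop} {ε : ℝ} (hε : 0 < ε) (hε' : ε ≤ 1 / 16)
    (h𝒞 : 𝒞 (u (saw ε hε hε') (saw ε hε hε') 1)) {C : ℝ}
    (hC : C < 2 * (1 - 4 * ε) / (Real.sqrt 3 * (3 - 4 * ε))) :
    ¬ StretchingSupBoundOn 𝒞 C := by
  obtain ⟨hlo, _⟩ := msq_saw_bounds hε hε'
  have hγ0 : 0 < msq (saw ε hε hε') := by linarith
  exact not_stretchingSupBoundOn_shear (saw ε hε hε') (saw ε hε hε') 1 h𝒞 (abs_deriv_saw_le hε hε')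
    (abs_deriv_saw_le hε hε') one_pos hγ0 hγ0 (hC.trans_le (ladder_ratio_le hε hε'))

/-- **`2√3/9 ≤ C_𝒞` for every class containing the ladder fields** (`ε → 0⁺` along
`tendsto_ladder`). Search for candidate a priori estimates; no regularity claim. [ours] -/
theorem two_sqrt_three_div_nine_le_stretchingSupConstOn
    {𝒞 : (UnitAddTorus (Fin 3) → EuclideanSpace ℝ (Fin 3)) → Prop}
    (h𝒞 : ∀ (ε : ℝ) (hε : 0 < ε) (hε' : ε ≤ 1 / 16), 𝒞 (u (saw ε hε hε') (saw ε hε hε') 1)) :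
    2 * Real.sqrt 3 / 9 ≤ stretchingSupConstOn 𝒞 := by
  refine le_of_tendsto tendsto_ladder ?_
  filter_upwards [Ioc_mem_nhdsGT (by norm_num : (0 : ℝ) < 1 / 16)] with ε hε
  exact le_of_forall_lt_imp_le_of_dense fun C hC =>
    le_stretchingSupConstOn (not_stretchingSupBoundOn_saw hε.1 hε.2 (h𝒞 ε hε.1 hε.2) hC)

/-- The ladder's first rung inside a class: `¬ StretchingSupBoundOn 𝒞 (1/4)` (`ε = 1/16`:
threshold `2(3/4)/(√3·(11/4)) = 6/(11√3) > 1/4`). [ours; elementary] -/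
theorem not_stretchingSupBoundOn_quarter
    {𝒞 : (UnitAddTorus (Fin 3) → EuclideanSpace ℝ (Fin 3)) → Prop}
    (h𝒞 : ∀ (ε : ℝ) (hε : 0 < ε) (hε' : ε ≤ 1 / 16), 𝒞 (u (saw ε hε hε') (saw ε hε hε') 1)) :
    ¬ StretchingSupBoundOn 𝒞 (1 / 4) := by
  have hε : (0 : ℝ) < 1 / 16 := by norm_num
  have hε' : (1 : ℝ) / 16 ≤ 1 / 16 := le_rfl
  refine not_stretchingSupBoundOn_saw hε hε' (h𝒞 _ hε hε') ?_
  have hs3 : 0 < Real.sqrt 3 := by positivity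
  have h3 : Real.sqrt 3 * Real.sqrt 3 = 3 := Real.mul_self_sqrt (by norm_num)
  have hs3lt : Real.sqrt 3 < 2 := by nlinarith
  rw [lt_div_iff₀ (by positivity)]
  nlinarith

end ShearComposition

/-! ## 2. The two class constants on `T³` (part 2: with the composition ladder) -/

/-- **`C_pressureless = 2√3/9` EXACTLY in the kernel**: the optimal constant of the K1-Q1 row on the
pressureless-gradient class (`|S|² = ½|ω|²` pointwise) is `2√3/9 ≈ 0.3849` — upper half by
Betchov–Miller (`σ = −4∫det S ≤ (2√6/9)∫|S|³`, tree p206571), lower half by the prove seat's composition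
fields (bank `K1Q1-PRESSURELESS.md`). Search for candidate a priori estimates; no regularity claim. [ours] -/
theorem stretchingSupConstOn_pressureless_eq :
    stretchingSupConstOn (IsPressurelessGrad (d := Fin 3)) = 2 * Real.sqrt 3 / 9 :=
  le_antisymm stretchingSupConstOn_isPressurelessGrad_le
    (ShearComposition.two_sqrt_three_div_nine_le_stretchingSupConstOn fun _ _ _ =>
      ShearComposition.isPressurelessGrad_u _ _ _)

/-- **`2√3/9 ≤ C_{2.5D}`** (the composition fields are 2½-dimensional). Search for candidate a priori
estimates; no regularity claim. [ours] -/
theorem two_sqrt_three_div_nine_le_stretchingSupConstOn_isTwoHalfD :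
    2 * Real.sqrt 3 / 9 ≤ stretchingSupConstOn (IsTwoHalfD (d := Fin 3)) :=
  ShearComposition.two_sqrt_three_div_nine_le_stretchingSupConstOn fun _ _ _ =>
    ShearComposition.isTwoHalfD_u _ _ _

/-- **`C_pressureless ≤ C_{2.5D} ≤ C⋆ ≤ 2/√3`**: the kernel's chain of K1-Q1 constants on `T³`
(`2√3/9 = C_pressureless`; `C⋆ < 2/√3` is the no-go seat's `not_stretchingSupSharp_fin3`, filed
separately). Search for candidate a priori estimates; no regularity claim. [ours] -/
theorem stretchingSupConstOn_chain :
    stretchingSupConstOn (IsPressurelessGrad (d := Fin 3)) ≤ stretchingSupConstOn (IsTwoHalfD (d := Fin 3)) ∧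
    stretchingSupConstOn (IsTwoHalfD (d := Fin 3)) ≤ stretchingSupConst (d := Fin 3) ∧
    stretchingSupConst (d := Fin 3) ≤ 2 / Real.sqrt 3 :=
  ⟨stretchingSupConstOn_pressureless_eq.trans_le two_sqrt_three_div_nine_le_stretchingSupConstOn_isTwoHalfD,
    stretchingSupConstOn_isTwoHalfD_le_stretchingSupConst, stretchingSupConst_le_holder⟩

end Summit.NavierStokesRegularity.FunctionalMining

end
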